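import Mathlib
import Summits.NavierStokesRegularity.NavierStokesRegularity.Theorems.TaoLadderRungTwoFlatCoMovingEnergyWindow
import HarnessLib

/-!
# L-54b — the TEMPLATE-FREE, CLOCK-WEIGHTED transport inequality for the co-moving energy (the behind zone of `H(n)`
  under ruling R54-1: `BehindEnergyClause`) (helper for the K_A♭ parent item stmt-NavierStokesRegularity-22987
  `FlatGapCertificatesV2`, child 2A `GradedAdiabaticWakeA` of route TaoLadderRungTwoFlat; cell harvest/h2-tao-ladder,
  p1 g22; theory-1 g42 ZONE-GEOMETRY-54 §2.2–2.3 / LADDER §54, (K8) BEHIND SLOSH repair)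

`…CoMovingEnergyRate.weightedSource_le_of_weight` / `…CoMovingEnergyDecay.coMovingEnergyOn_decay_Icc` (L8b-1) take a
template `W` (bound `M`), a UNIFORM amplitude bound `|u| ≤ A` and a clock bound `c̄` on the block. For the behind zone
of the hop frame the state itself is transported (template `W = 0`, so the cross term vanishes and `M = 0`), and deep
behind shells legally carry amplitudes `≫ A_thr` while their clocks are tiny: the right hypothesis is the CLOCK-WEIGHTED
amplitude `c_n·|u_{1,n}|, c_n·|u_{0,n+1}| ≤ A_eff` on each bond `n` of the block (theory-1's L-54b). Same proofs,
per-bond constants: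

* `abs_fluxT_le_clockWeighted` — `|T_n(u)| ≤ (1+ε)·A_eff·|u_{1,n}||u_{0,n+1}|`;
* `weighted_flux_sum_clockWeighted` — `Σ (φ_{n+1} − φ_n)|T_n| ≤ (1+ε)A_eff sinh(θ/2)·Σ(φ_n v_n² + φ_{n+1}a_{n+1}²)`;
* `freeSource_le_of_weight` — block rate bound with NO template:
  `Σ_{[a,P]} φ_n(T_{n−1} − T_n) ≤ 2(1+ε)A_eff sinh(θ/2)·Σ φ_n ½|u_n|² + φ_a|T_{a−1}| + φ_P|T_P|`;
* `coMovingEnergyOn_transport_Icc` — for a SOLUTION `u` (`u̇ = Q(u)` on the block, open interval; continuous on the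
  closure): `V(t₂) ≤ e^{−μ(t₂−t₁)}V(t₁) + Ē(1 − e^{−μ(t₂−t₁)})/μ` for any `0 < μ ≤ σθ − 2(1+ε)A_eff sinh(θ/2)`, `Ē` the
  two edge fluxes in the co-moving weights — the transport side `σθ` races only the clock-weighted junk `A_eff`
  (R54.transport_margin: `s ≥ 1 − √3/2` at the (JB) level);
* `coMovingEnergyOn_transport_of_pseudoFlow` — the same along ONE exact graded window flow `PseudoFlowOnShift S♭ τ ε₀ T♭(ε) 0 …`.

HONEST FRAMING: inequalities about MODEL-lattice states/flows (Tao 2016 §4 vocabulary on `S♭`); all bounds are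
HYPOTHESES; nothing certified; nothing about the Navier–Stokes equations.
-/

noncomputable section

-- the sub-problem namespace repeats the summit name by design (D-0017)
set_option linter.dupNamespace false

namespace Summit.NavierStokesRegularity.NavierStokesRegularity.Theorems

open Set Filter Literature.Analysis.FluidPDE Literature.Analysis.FluidPDE.TaoCascade
open scoped Topology

namespace MirrorPulse

/-! ### 1. Flux bounds with clock-weighted amplitudes -/

/-- **Clock-weighted flux bound**: `c_n|u_{1,n}| ≤ A_eff` and `c_n|u_{0,n+1}| ≤ A_eff` give
`|T_n(u)| ≤ (1+ε)·A_eff·|u_{1,n}|·|u_{0,n+1}|` (`0 ≤ ε`, `−1 ≤ ε₀`).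
[cite: Tao2016AveragedNS, §4 (4.3); route TaoLadderRungTwoFlat, L-54b (ZONE-GEOMETRY-54 §2.2)] -/
theorem abs_fluxT_le_clockWeighted {ε ε₀ Aeff : ℝ} (hε : 0 ≤ ε) (hε₀ : -1 ≤ ε₀) (X : Fin 2 → ℤ → ℝ → ℝ)
    (n : ℤ) (t : ℝ) (hv : clock ε₀ n * |X 1 n t| ≤ Aeff) (ha : clock ε₀ n * |X 0 (n + 1) t| ≤ Aeff) :
    |fluxT ε ε₀ X n t| ≤ (1 + ε) * Aeff * (|X 1 n t| * |X 0 (n + 1) t|) := by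
  have hc : 0 ≤ clock ε₀ n := clock_nonneg hε₀ n
  unfold fluxT
  rw [abs_mul, abs_mul, abs_mul, abs_of_nonneg hc]
  have h3 : clock ε₀ n * |X 1 n t + ε * X 0 (n + 1) t| ≤ (1 + ε) * Aeff := by
    calc clock ε₀ n * |X 1 n t + ε * X 0 (n + 1) t|
        ≤ clock ε₀ n * (|X 1 n t| + ε * |X 0 (n + 1) t|) := by
          refine mul_le_mul_of_nonneg_left ?_ hc
          calc |X 1 n t + ε * X 0 (n + 1) t| ≤ |X 1 n t| + |ε * X 0 (n + 1) t| := abs_add_le _ _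
            _ = |X 1 n t| + ε * |X 0 (n + 1) t| := by rw [abs_mul, abs_of_nonneg hε]
      _ = clock ε₀ n * |X 1 n t| + ε * (clock ε₀ n * |X 0 (n + 1) t|) := by ring
      _ ≤ Aeff + ε * Aeff := add_le_add hv (mul_le_mul_of_nonneg_left ha hε)
      _ = (1 + ε) * Aeff := by ring
  have hpq : 0 ≤ |X 1 n t| * |X 0 (n + 1) t| := by positivity
  calc clock ε₀ n * |X 1 n t| * |X 0 (n + 1) t| * |X 1 n t + ε * X 0 (n + 1) t|
      = (clock ε₀ n * |X 1 n t + ε * X 0 (n + 1) t|) * (|X 1 n t| * |X 0 (n + 1) t|) := by ring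
    _ ≤ (1 + ε) * Aeff * (|X 1 n t| * |X 0 (n + 1) t|) := mul_le_mul_of_nonneg_right h3 hpq

/-- **Clock-weighted WEIGHTED FLUX SUM**: weights `φ ≥ 0` with `φ(n+1) = e^θ φ(n)` (`θ ≥ 0`), clock-weighted amplitudes
`≤ A_eff` on the bonds of `s`: `Σ_{n∈s}(φ(n+1) − φ(n))|T_n| ≤ (1+ε)A_eff sinh(θ/2)·Σ_{n∈s}(φ(n)v_n² + φ(n+1)a_{n+1}²)`.
[cite: Tao2016AveragedNS, §4 (4.3); route TaoLadderRungTwoFlat, L-54b] -/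
theorem weighted_flux_sum_clockWeighted {ε ε₀ Aeff θ : ℝ} (hε : 0 ≤ ε) (hε₀ : -1 ≤ ε₀) (hθ : 0 ≤ θ)
    (hAeff : 0 ≤ Aeff) (X : Fin 2 → ℤ → ℝ → ℝ) (t : ℝ) (s : Finset ℤ) (φ : ℤ → ℝ) (hφ : ∀ n, 0 ≤ φ n)
    (hφs : ∀ n, φ (n + 1) = Real.exp θ * φ n)
    (hbd : ∀ n ∈ s, clock ε₀ n * |X 1 n t| ≤ Aeff ∧ clock ε₀ n * |X 0 (n + 1) t| ≤ Aeff) :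
    ∑ n ∈ s, (φ (n + 1) - φ n) * |fluxT ε ε₀ X n t|
      ≤ (1 + ε) * Aeff * Real.sinh (θ / 2) * ∑ n ∈ s, (φ n * X 1 n t ^ 2 + φ (n + 1) * X 0 (n + 1) t ^ 2) := by
  have hsinh : 0 ≤ Real.sinh (θ / 2) := Real.sinh_nonneg_iff.mpr (by linarith)
  rw [Finset.mul_sum]
  refine Finset.sum_le_sum fun n hn => ?_
  have hφn := hφ n
  have hT := abs_fluxT_le_clockWeighted hε hε₀ X n t (hbd n hn).1 (hbd n hn).2
  have hag := weighted_amgm hθ (X 1 n t) (X 0 (n + 1) t)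
  have he1 : 0 ≤ Real.exp θ - 1 := by linarith [Real.one_le_exp hθ]
  calc (φ (n + 1) - φ n) * |fluxT ε ε₀ X n t|
      = φ n * (Real.exp θ - 1) * |fluxT ε ε₀ X n t| := by rw [hφs n]; ring
    _ ≤ φ n * (Real.exp θ - 1) * ((1 + ε) * Aeff * (|X 1 n t| * |X 0 (n + 1) t|)) :=
        mul_le_mul_of_nonneg_left hT (mul_nonneg hφn he1)
    _ = φ n * ((1 + ε) * Aeff) * ((Real.exp θ - 1) * (|X 1 n t| * |X 0 (n + 1) t|)) := by ring
    _ ≤ φ n * ((1 + ε) * Aeff) * (Real.sinh (θ / 2) * (X 1 n t ^ 2 + Real.exp θ * X 0 (n + 1) t ^ 2)) :=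
        mul_le_mul_of_nonneg_left hag (by positivity)
    _ = (1 + ε) * Aeff * Real.sinh (θ / 2) * (φ n * X 1 n t ^ 2 + φ (n + 1) * X 0 (n + 1) t ^ 2) := by
        rw [hφs n]; ring

/-! ### 2. The template-free rate bound on a block -/

/-- **TEMPLATE-FREE RATE BOUND** on a block `[a, P]`: weight `φ > 0`, `φ(n+1) = e^θφ(n)` (`θ ≥ 0`), clock-weighted
amplitudes `≤ A_eff` on the bonds `a−1 … P`:
`Σ_{n=a}^{P} φ_n (T_{n−1}(u) − T_n(u)) ≤ 2(1+ε)A_eff sinh(θ/2)·Σ_{n=a}^{P} φ_n ½|u_n|² + φ_a|T_{a−1}| + φ_P|T_P|`.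
[cite: Tao2016AveragedNS, §4 (4.3); route TaoLadderRungTwoFlat, L-54b (the W = 0 case of `weightedSource_le_of_weight`)] -/
theorem freeSource_le_of_weight {ε ε₀ θ Aeff : ℝ} (hε : 0 ≤ ε) (hε₀ : -1 ≤ ε₀) (hθ : 0 ≤ θ) (hAeff : 0 ≤ Aeff)
    {a P : ℤ} (haP : a ≤ P) (u : Fin 2 → ℤ → ℝ → ℝ) (t : ℝ) (φ : ℤ → ℝ) (hφpos : ∀ n, 0 < φ n)
    (hφs : ∀ n, φ (n + 1) = Real.exp θ * φ n)
    (hbd : ∀ n ∈ Finset.Icc (a - 1) P, clock ε₀ n * |u 1 n t| ≤ Aeff ∧ clock ε₀ n * |u 0 (n + 1) t| ≤ Aeff) :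
    ∑ n ∈ Finset.Icc a P, φ n * (fluxT ε ε₀ u (n - 1) t - fluxT ε ε₀ u n t)
      ≤ 2 * (1 + ε) * Aeff * Real.sinh (θ / 2) * ∑ n ∈ Finset.Icc a P, φ n * ((u 0 n t ^ 2 + u 1 n t ^ 2) / 2)
        + (φ a * |fluxT ε ε₀ u (a - 1) t| + φ P * |fluxT ε ε₀ u P t|) := by
  have hφnn : ∀ n, 0 ≤ φ n := fun n => (hφpos n).le
  have hmono : ∀ n, φ n ≤ φ (n + 1) := fun n => by
    rw [hφs]; exact le_mul_of_one_le_left (hφnn n) (Real.one_le_exp hθ)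
  have hsinh : 0 ≤ Real.sinh (θ / 2) := Real.sinh_nonneg_iff.mpr (by linarith)
  -- the two species sums
  have hV : ∑ n ∈ Finset.Icc a P, φ n * ((u 0 n t ^ 2 + u 1 n t ^ 2) / 2)
      = ((∑ n ∈ Finset.Icc a P, φ n * u 0 n t ^ 2) + ∑ n ∈ Finset.Icc a P, φ n * u 1 n t ^ 2) / 2 := by
    rw [← Finset.sum_add_distrib, Finset.sum_div]
    refine Finset.sum_congr rfl fun n _ => ?_
    ring
  rw [hV, abel_sum_Icc φ (fun k => fluxT ε ε₀ u k t) haP]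
  -- edge terms
  have e1 : φ a * fluxT ε ε₀ u (a - 1) t ≤ φ a * |fluxT ε ε₀ u (a - 1) t| :=
    mul_le_mul_of_nonneg_left (le_abs_self _) (hφnn a)
  have e2 : -(φ P * fluxT ε ε₀ u P t) ≤ φ P * |fluxT ε ε₀ u P t| := by
    rw [← mul_neg]; exact mul_le_mul_of_nonneg_left (neg_le_abs _) (hφnn P)
  -- interior bonds
  have e3 : ∑ n ∈ Finset.Ico a P, (φ (n + 1) - φ n) * fluxT ε ε₀ u n t
      ≤ ∑ n ∈ Finset.Ico a P, (φ (n + 1) - φ n) * |fluxT ε ε₀ u n t| :=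
    Finset.sum_le_sum fun n _ => mul_le_mul_of_nonneg_left (le_abs_self _) (by linarith [hmono n])
  have hbd' : ∀ n ∈ Finset.Ico a P, clock ε₀ n * |u 1 n t| ≤ Aeff ∧ clock ε₀ n * |u 0 (n + 1) t| ≤ Aeff := by
    intro n hn
    have hn' := Finset.mem_Ico.mp hn
    exact hbd n (Finset.mem_Icc.mpr ⟨by omega, by omega⟩)
  have e4 := weighted_flux_sum_clockWeighted hε hε₀ hθ hAeff u t (Finset.Ico a P) φ hφnn hφs hbd'
  have e5 : ∑ n ∈ Finset.Ico a P, (φ n * u 1 n t ^ 2 + φ (n + 1) * u 0 (n + 1) t ^ 2)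
      ≤ (∑ n ∈ Finset.Icc a P, φ n * u 0 n t ^ 2) + ∑ n ∈ Finset.Icc a P, φ n * u 1 n t ^ 2 := by
    rw [Finset.sum_add_distrib]
    have h1 : ∑ n ∈ Finset.Ico a P, φ n * u 1 n t ^ 2 ≤ ∑ n ∈ Finset.Icc a P, φ n * u 1 n t ^ 2 :=
      Finset.sum_le_sum_of_subset_of_nonneg Finset.Ico_subset_Icc_self
        fun n _ _ => mul_nonneg (hφnn n) (sq_nonneg _)
    have h2 : ∑ n ∈ Finset.Ico a P, φ (n + 1) * u 0 (n + 1) t ^ 2 ≤ ∑ n ∈ Finset.Icc a P, φ n * u 0 n t ^ 2 := by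
      rw [sum_Ico_add_shift (fun m => φ m * u 0 m t ^ 2) a P 1]
      refine Finset.sum_le_sum_of_subset_of_nonneg ?_ fun n _ _ => mul_nonneg (hφnn n) (sq_nonneg _)
      intro m hm
      rw [Finset.mem_Ico] at hm
      exact Finset.mem_Icc.mpr ⟨by omega, by omega⟩
    linarith
  have hK : 0 ≤ (1 + ε) * Aeff * Real.sinh (θ / 2) := by positivity
  have e6 := mul_le_mul_of_nonneg_left e5 hK
  linarith [e1, e2, e3, e4, e6]

/-! ### 3. Transport decay for a solution (no template) -/

/-- The quadratic term of the zero family vanishes. [cite: Tao2016AveragedNS, §4 (4.8); route TaoLadderRungTwoFlat, L-54b] -/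
theorem quadTermOn_zero_family (ε ε₀ : ℝ) (i : Fin 2) (n : ℤ) (t : ℝ) :
    quadTermOn shiftSetFlat ε₀ (mirrorTable ε ε) (0 : Fin 2 → ℤ → ℝ → ℝ) i n t = 0 := by
  simp [quadTermOn]

/-- The linearisation at the zero template vanishes. [cite: Tao2016AveragedNS, §4 (4.8); route TaoLadderRungTwoFlat, L-54b] -/
theorem linTermOn_zero_template (ε ε₀ : ℝ) (u : Fin 2 → ℤ → ℝ → ℝ) (i : Fin 2) (n : ℤ) (t : ℝ) :
    QuadPolar.linTermOn shiftSetFlat ε₀ (mirrorTable ε ε) (0 : Fin 2 → ℤ → ℝ → ℝ) u i n t = 0 := by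
  simp [QuadPolar.linTermOn, QuadPolar.bilinOn]

/-- **TEMPLATE-FREE TRANSPORT INEQUALITY (L-54b).** `u` solves the lattice (`u̇ = Q(u)`) on the block `[a,P]` for
`t ∈ (t₁,t₂)` and is continuous on `[t₁,t₂]` there; clock-weighted amplitudes `c_n|u_{1,n}|, c_n|u_{0,n+1}| ≤ A_eff` on
the bonds `a−1 … P` for `t ∈ (t₁,t₂)`; the two edge fluxes in the co-moving weights are `≤ Ē`; a rate
`0 < μ ≤ σθ − 2(1+ε)A_eff sinh(θ/2)`. Then, with the edge at `n_e(t) = n₀ + σt`,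
`V_{[a,P]}(t₂) ≤ e^{−μ(t₂−t₁)}V_{[a,P]}(t₁) + Ē(1 − e^{−μ(t₂−t₁)})/μ`.
[cite: Tao2016AveragedNS, §4 (4.3), (4.8), §5–§6; route TaoLadderRungTwoFlat, L-54b ⇒ R54-1 `BehindEnergyClause` transport (LADDER §54)] -/
theorem coMovingEnergyOn_transport_Icc {ε ε₀ θ σ n₀ Aeff μ Ebar t₁ t₂ : ℝ} (hε : 0 ≤ ε) (hε₀ : -1 ≤ ε₀)
    (hθ : 0 ≤ θ) (hAeff : 0 ≤ Aeff) {a P : ℤ} (haP : a ≤ P) (ht : t₁ ≤ t₂) {u : Fin 2 → ℤ → ℝ → ℝ}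
    (hcont : ∀ i, ∀ n ∈ Finset.Icc a P, ContinuousOn (u i n) (Icc t₁ t₂))
    (hder : ∀ t ∈ Ioo t₁ t₂, ∀ i, ∀ n ∈ Finset.Icc a P,
      HasDerivAt (u i n) (quadTermOn shiftSetFlat ε₀ (mirrorTable ε ε) u i n t) t)
    (hbd : ∀ t ∈ Ioo t₁ t₂, ∀ n ∈ Finset.Icc (a - 1) P,
      clock ε₀ n * |u 1 n t| ≤ Aeff ∧ clock ε₀ n * |u 0 (n + 1) t| ≤ Aeff)
    (hE : ∀ t ∈ Ioo t₁ t₂,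
      Real.exp (θ * ((a : ℝ) - (n₀ + σ * t))) * |fluxT ε ε₀ u (a - 1) t|
        + Real.exp (θ * ((P : ℝ) - (n₀ + σ * t))) * |fluxT ε ε₀ u P t| ≤ Ebar)
    (hμ : 0 < μ) (hμle : μ ≤ σ * θ - 2 * (1 + ε) * Aeff * Real.sinh (θ / 2)) :
    coMovingEnergyOn (Finset.Icc a P) θ (n₀ + σ * t₂) u t₂
      ≤ Real.exp (-μ * (t₂ - t₁)) * coMovingEnergyOn (Finset.Icc a P) θ (n₀ + σ * t₁) u t₁
        + Ebar * (1 - Real.exp (-μ * (t₂ - t₁))) / μ := by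
  -- `u̇ = Q(0 + u) − Q(0)`
  have hder' : ∀ t ∈ Ioo t₁ t₂, ∀ i, ∀ n ∈ Finset.Icc a P,
      HasDerivAt (u i n) (quadTermOn shiftSetFlat ε₀ (mirrorTable ε ε) ((0 : Fin 2 → ℤ → ℝ → ℝ) + u) i n t
        - quadTermOn shiftSetFlat ε₀ (mirrorTable ε ε) (0 : Fin 2 → ℤ → ℝ → ℝ) i n t) t := by
    intro t ht' i n hn
    rw [zero_add, quadTermOn_zero_family, sub_zero]
    exact hder t ht' i n hn
  refine le_exp_neg_mul_add_of_deriv_le (V := fun t => coMovingEnergyOn (Finset.Icc a P) θ (n₀ + σ * t) u t)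
    ht hμ (continuousOn_coMovingEnergyOn (Finset.Icc a P) hcont)
    (fun t ht' => hasDerivAt_coMovingEnergyOn (Finset.Icc a P) (hder' t ht')) ?_
  intro t ht'
  -- the source with zero template is the pure flux part
  have hcross : ∀ n ∈ Finset.Icc a P, Real.exp (θ * ((n : ℝ) - (n₀ + σ * t))) *
      ((fluxT ε ε₀ u (n - 1) t - fluxT ε ε₀ u n t)
        + ∑ i : Fin 2, u i n t * QuadPolar.linTermOn shiftSetFlat ε₀ (mirrorTable ε ε)
            (0 : Fin 2 → ℤ → ℝ → ℝ) u i n t)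
      = Real.exp (θ * ((n : ℝ) - (n₀ + σ * t))) * (fluxT ε ε₀ u (n - 1) t - fluxT ε ε₀ u n t) := by
    intro n _
    simp only [linTermOn_zero_template, mul_zero, Finset.sum_const_zero, add_zero]
  rw [Finset.sum_congr rfl hcross]
  -- geometric weight φ_n = e^{θ(n − n_e(t))}
  have hφpos : ∀ n : ℤ, 0 < Real.exp (θ * ((n : ℝ) - (n₀ + σ * t))) := fun n => Real.exp_pos _
  have hφs : ∀ n : ℤ, Real.exp (θ * (((n + 1 : ℤ) : ℝ) - (n₀ + σ * t)))
      = Real.exp θ * Real.exp (θ * ((n : ℝ) - (n₀ + σ * t))) := by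
    intro n
    rw [← Real.exp_add]
    push_cast
    ring_nf
  have hsrc := freeSource_le_of_weight hε hε₀ hθ hAeff haP u t
    (fun n : ℤ => Real.exp (θ * ((n : ℝ) - (n₀ + σ * t)))) hφpos hφs (hbd t ht')
  have hV0 := coMovingEnergyOn_nonneg (Finset.Icc a P) θ (n₀ + σ * t) u t
  have hEt := hE t ht'
  have hVdef : coMovingEnergyOn (Finset.Icc a P) θ (n₀ + σ * t) u t
      = ∑ n ∈ Finset.Icc a P, Real.exp (θ * ((n : ℝ) - (n₀ + σ * t))) * ((u 0 n t ^ 2 + u 1 n t ^ 2) / 2) := rfl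
  have hrate : 2 * (1 + ε) * Aeff * Real.sinh (θ / 2) * coMovingEnergyOn (Finset.Icc a P) θ (n₀ + σ * t) u t
      ≤ (σ * θ - μ) * coMovingEnergyOn (Finset.Icc a P) θ (n₀ + σ * t) u t :=
    mul_le_mul_of_nonneg_right (by linarith) hV0
  rw [← hVdef] at hsrc
  linarith

/-- **L-54b ALONG ONE EXACT GRADED WINDOW FLOW.** For `PseudoFlowOnShift S♭ τ ε₀ T♭(ε) 0 κ₂ S₀ F₀ B₀ S F` and
`0 ≤ t₁ ≤ t₂ ≤ τ`: the transport inequality of `coMovingEnergyOn_transport_Icc` for `u := S` (the state itself, no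
template), under the clock-weighted amplitude bound on the block's bonds and the edge-flux bound.
[cite: Tao2016AveragedNS, §4 (4.3), (4.8), §5–§6; route TaoLadderRungTwoFlat, L-54b / R54-1 (`HopTube.R54.BehindEnergyClause` is transport-invariant; LADDER §54)] -/
theorem coMovingEnergyOn_transport_of_pseudoFlow {ε ε₀ τ κ₂ θ σ n₀ Aeff μ Ebar t₁ t₂ : ℝ}
    {S₀ F₀ B₀ : Fin 2 → ℤ → ℝ} {S F : Fin 2 → ℤ → ℝ → ℝ}
    (hS : PseudoFlowOnShift shiftSetFlat τ ε₀ (mirrorTable ε ε) 0 κ₂ S₀ F₀ B₀ S F)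
    (hε : 0 ≤ ε) (hε₀ : -1 ≤ ε₀) (hθ : 0 ≤ θ) (hAeff : 0 ≤ Aeff) {a P : ℤ} (haP : a ≤ P)
    (h0t₁ : 0 ≤ t₁) (ht : t₁ ≤ t₂) (ht₂ : t₂ ≤ τ)
    (hbd : ∀ t ∈ Ioo t₁ t₂, ∀ n ∈ Finset.Icc (a - 1) P,
      clock ε₀ n * |S 1 n t| ≤ Aeff ∧ clock ε₀ n * |S 0 (n + 1) t| ≤ Aeff)
    (hE : ∀ t ∈ Ioo t₁ t₂,
      Real.exp (θ * ((a : ℝ) - (n₀ + σ * t))) * |fluxT ε ε₀ S (a - 1) t|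
        + Real.exp (θ * ((P : ℝ) - (n₀ + σ * t))) * |fluxT ε ε₀ S P t| ≤ Ebar)
    (hμ : 0 < μ) (hμle : μ ≤ σ * θ - 2 * (1 + ε) * Aeff * Real.sinh (θ / 2)) :
    coMovingEnergyOn (Finset.Icc a P) θ (n₀ + σ * t₂) S t₂
      ≤ Real.exp (-μ * (t₂ - t₁)) * coMovingEnergyOn (Finset.Icc a P) θ (n₀ + σ * t₁) S t₁
        + Ebar * (1 - Real.exp (-μ * (t₂ - t₁))) / μ := by
  have hsub : Icc t₁ t₂ ⊆ Icc 0 τ := Icc_subset_Icc h0t₁ ht₂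
  have hcont : ∀ i, ∀ n ∈ Finset.Icc a P, ContinuousOn (S i n) (Icc t₁ t₂) := fun i n _ =>
    (QuadPolar.continuousOn_of_pseudoFlowOnShift hS i n).mono hsub
  have hder : ∀ t ∈ Ioo t₁ t₂, ∀ i, ∀ n ∈ Finset.Icc a P,
      HasDerivAt (S i n) (quadTermOn shiftSetFlat ε₀ (mirrorTable ε ε) S i n t) t :=
    fun t ht' i n _ => QuadPolar.hasDerivAt_of_pseudoFlowOnShift_exact hS i n ⟨h0t₁.trans_lt ht'.1, ht'.2.trans_le ht₂⟩
  exact coMovingEnergyOn_transport_Icc hε hε₀ hθ hAeff haP ht hcont hder hbd hE hμ hμle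

end MirrorPulse

end Summit.NavierStokesRegularity.NavierStokesRegularity.Theorems

end
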